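import Summits.CriticalPhenomena.PercolationContinuityZ3.Theorems.PercNearOneGluingNoHeavyLowerTailSunflowerThreeBlockComb
import Summits.CriticalPhenomena.PercolationContinuityZ3.Theorems.PercNearOneGluingNoHeavyLowerTailSunflowerForcedReduction
import HarnessLib
import HarnessLib.Audit

/-!
# `NoHeavyLowerTail` (crux stmt-CriticalPhenomena-4575), abstract sunflower cubic: the THREE-BLOCK theorem in DIRECT form — the partition lemma
# (rows H, G, T) for every CARDINALITY-DETERMINED sunflower on a three-block ground set

Support file (seat `prim-ineq-gen-2` gen 21; `--supports stmt-CriticalPhenomena-4575`; corollary of `…SunflowerThreeBlockComb`, p279797, whose compiled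
evaluation it inherits).  No `sorry`, no named facts.  Memo: run/shared/lean/prim/prim-ineq-gen-2/THREEBLOCK-LEAN-GEN21.md.

`ThreeBlockComb.ZH_composeC_nonneg_three_blocks` states ★ for sunflowers PRESENTED as a chain composition `G.composeC h`.  This file removes the presentation:
a sunflower `F` on a disjoint union `Σ b : Fin 3, β b` is CARDINALITY-DETERMINED (`IsCardDetermined F`) if membership of a set in each up-set depends only on the
three slice cardinalities `#(S ∩ β b)` — equivalently, `F` is invariant under the Young subgroup `S_{β 0} × S_{β 1} × S_{β 2}`.  Such an `F` IS the chain composition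
of its CARDINALITY QUOTIENT `quotOf F` (a sunflower on the threshold set `Σ b, Fin |β b|`, read through canonical representatives `canon`) with the cardinality
gadget `cardGadget` (`composeC_quotOf_V`), hence

* **`ZH_nonneg_of_isCardDetermined`**, `ZG_…`, `ZT_…` : `0 ≤ F.ZH`, `0 ≤ F.ZG`, `0 ≤ F.ZT` for every cardinality-determined sunflower on three finite blocks —
  all 3-parameter families `S ↦ ψ(#(S ∩ E₀), #(S ∩ E₁), #(S ∩ E₂))` with `ψ : [n₀+1]×[n₁+1]×[n₂+1] → M₃` monotone (cyclic stars, doubled/tripled stars, threshold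
  products and stars, …).
-/

namespace Summit.CriticalPhenomena.PercolationContinuityZ3.Theorems.SunflowerPartition

open Finset

namespace ThreeBlockComb

open ChainComb

variable {β : Fin 3 → Type*} [∀ b, Fintype (β b)] [∀ b, DecidableEq (β b)]

/-- The heights of the cardinality quotient: the block sizes. [this work] -/
abbrev hts (β : Fin 3 → Type*) [∀ b, Fintype (β b)] : Fin 3 → ℕ := fun b => Fintype.card (β b)

/-- The CARDINALITY GADGET: each block is read through the cardinality of the slice. [this work] -/
def cardGadget (β : Fin 3 → Type*) [∀ b, Fintype (β b)] [∀ b, DecidableEq (β b)] : CGadget β (hts β) where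
  lv _ S := ⟨#S, Nat.lt_succ_of_le (card_le_univ S)⟩
  mono _ _ _ hST := Fin.mk_le_mk.2 (card_le_card hST)

/-- The CANONICAL REPRESENTATIVE of a subset of the threshold set: in block `b`, the first `#(slice T b)` elements of `β b` (in the order of `Fintype.equivFin`).
[this work] -/
noncomputable def canon (T : Finset (Σ b, Fin (hts β b))) : Finset (Σ b, β b) :=
  univ.filter fun x => (Fintype.equivFin (β x.1) x.2).val < #(slice T x.1)

omit [∀ b, DecidableEq (β b)] in
/-- A slice of the threshold set has at most `|β b|` elements. [this work] -/
theorem card_slice_le (T : Finset (Σ b, Fin (hts β b))) (b : Fin 3) : #(slice T b) ≤ Fintype.card (β b) :=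
  (card_le_univ _).trans (by simp)

omit [∀ b, DecidableEq (β b)] in
/-- Canonical representatives are monotone. [this work] -/
theorem canon_mono {T T' : Finset (Σ b, Fin (hts β b))} (h : T ⊆ T') : canon T ⊆ canon T' := by
  intro x hx
  simp only [canon, mem_filter, mem_univ, true_and] at hx ⊢
  exact lt_of_lt_of_le hx (card_le_card (slice_mono h x.1))

/-- The canonical representative has the prescribed slice cardinalities. [this work] -/
theorem card_slice_canon (T : Finset (Σ b, Fin (hts β b))) (b : Fin 3) : #(slice (canon T) b) = #(slice T b) := by
  have h1 : slice (canon T) b = (univ.filter fun i : Fin (hts β b) => i.val < #(slice T b)).map (Fintype.equivFin (β b)).symm.toEmbedding := by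
    ext y
    simp only [mem_slice, canon, mem_filter, mem_univ, true_and, mem_map, Equiv.coe_toEmbedding]
    constructor
    · intro hy
      exact ⟨Fintype.equivFin (β b) y, hy, by simp⟩
    · rintro ⟨i, hi, rfl⟩
      simpa using hi
  rw [h1, card_map, Fin.card_filter_val_lt, Nat.min_eq_right (card_slice_le T b)]

/-- The hit set of the cardinality gadget has the slice cardinalities of the set. [this work] -/
theorem card_slice_hits (S : Finset (Σ b, β b)) (b : Fin 3) : #(slice ((cardGadget β).hits S) b) = #(slice S b) := by
  have h1 : slice ((cardGadget β).hits S) b = univ.filter fun i : Fin (hts β b) => i.val < #(slice S b) := by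
    ext i
    simp [mem_slice, CGadget.mem_hits, cardGadget]
  rw [h1, Fin.card_filter_val_lt, Nat.min_eq_right ((card_le_univ _).trans (by simp))]

/-- The CARDINALITY QUOTIENT of a sunflower on three blocks: a threshold subset is in up-set `k` iff its canonical representative is. [this work] -/
noncomputable def quotOf (F : Sunflower (Σ b, β b)) : Sunflower (Σ b, Fin (hts β b)) where
  V k := univ.filter fun T => canon T ∈ F.V k
  upper := by
    intro k T T' hTT' hT
    have hT' : T ∈ univ.filter fun T : Finset (Σ b, Fin (hts β b)) => canon T ∈ F.V k := hT
    show T' ∈ univ.filter fun T : Finset (Σ b, Fin (hts β b)) => canon T ∈ F.V k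
    rw [mem_filter] at hT' ⊢
    exact ⟨mem_univ _, F.upper k (canon_mono hTT') hT'.2⟩
  inter_eq := by
    intro i j hij
    ext T
    simp only [mem_inter, mem_filter, mem_univ, true_and]
    have h1 := F.inter_eq i j hij
    constructor
    · intro hT
      have : canon T ∈ F.V i ∩ F.V j := mem_inter.2 hT
      rw [h1] at this
      exact mem_inter.1 this
    · intro hT
      have : canon T ∈ F.V 0 ∩ F.V 1 := mem_inter.2 hT
      rw [← h1] at this
      exact mem_inter.1 this

/-- Membership in the up-sets of the cardinality quotient. [this work] -/
theorem mem_quotOf_V (F : Sunflower (Σ b, β b)) (k : Fin 3) (T : Finset (Σ b, Fin (hts β b))) :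
    T ∈ (quotOf F).V k ↔ canon T ∈ F.V k := by
  show T ∈ univ.filter (fun T : Finset (Σ b, Fin (hts β b)) => canon T ∈ F.V k) ↔ _
  simp

/-- CARDINALITY-DETERMINED sunflowers on a three-block ground set: membership in each up-set depends only on the three slice cardinalities
(equivalently: invariance under the Young subgroup `S_{β 0} × S_{β 1} × S_{β 2}`). [this work] -/
def IsCardDetermined (F : Sunflower (Σ b, β b)) : Prop :=
  ∀ S T : Finset (Σ b, β b), (∀ b, #(slice S b) = #(slice T b)) → ∀ k, S ∈ F.V k ↔ T ∈ F.V k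

/-- **A cardinality-determined sunflower is the chain composition of its cardinality quotient with the cardinality gadget** (equality of up-sets). [this work] -/
theorem composeC_quotOf_V {F : Sunflower (Σ b, β b)} (hF : IsCardDetermined F) (k : Fin 3) :
    ((quotOf F).composeC (cardGadget β)).V k = F.V k := by
  ext S
  rw [Sunflower.mem_composeC_V, mem_quotOf_V]
  exact hF _ _ (fun b => by rw [card_slice_canon, card_slice_hits]) k

/-- **★_H for every cardinality-determined sunflower on three finite blocks.** [this work] -/
theorem ZH_nonneg_of_isCardDetermined {F : Sunflower (Σ b, β b)} (hF : IsCardDetermined F) : 0 ≤ F.ZH := by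
  rw [← Sunflower.ZH_congr (F := (quotOf F).composeC (cardGadget β)) (fun k => composeC_quotOf_V hF k)]
  exact ZH_composeC_nonneg_three_blocks (quotOf F) (cardGadget β)

/-- The kernel-generic partition functional only depends on the three up-sets. [this work] -/
theorem Zp_congr_of_V {α : Type*} [Fintype α] [DecidableEq α] {F G : Sunflower α} (h : ∀ i, F.V i = G.V i)
    (κ : Fin 5 → Fin 5 → Fin 5 → ℤ) : F.Zp κ = G.Zp κ := by
  unfold Sunflower.Zp
  exact sum_congr rfl fun q _ => by rw [Sunflower.lab_congr h, Sunflower.lab_congr h, Sunflower.lab_congr h]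

/-- ★_G for every cardinality-determined sunflower on three finite blocks. [this work] -/
theorem ZG_nonneg_of_isCardDetermined {F : Sunflower (Σ b, β b)} (hF : IsCardDetermined F) : 0 ≤ F.ZG := by
  rw [Sunflower.ZG_eq_Zp, ← Zp_congr_of_V (F := (quotOf F).composeC (cardGadget β)) (fun k => composeC_quotOf_V hF k),
    ← Sunflower.ZG_eq_Zp]
  exact ZG_composeC_nonneg_three_blocks (quotOf F) (cardGadget β)

/-- ★_T for every cardinality-determined sunflower on three finite blocks. [this work] -/
theorem ZT_nonneg_of_isCardDetermined {F : Sunflower (Σ b, β b)} (hF : IsCardDetermined F) : 0 ≤ F.ZT := by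
  rw [Sunflower.ZT_eq_Zp, ← Zp_congr_of_V (F := (quotOf F).composeC (cardGadget β)) (fun k => composeC_quotOf_V hF k),
    ← Sunflower.ZT_eq_Zp]
  exact ZT_composeC_nonneg_three_blocks (quotOf F) (cardGadget β)

end ThreeBlockComb

end Summit.CriticalPhenomena.PercolationContinuityZ3.Theorems.SunflowerPartition
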